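import Literature.Analysis.FluidPDE.TsaiSelfSimilarBounded
import HarnessLib

/-!
# HarmonicShellPoissonUnique — plate E3 of ROUND-41 «IsotropicBlobPressureLaw» (S-door lane):
# the DECAYING classical solution of a Poisson equation on a finite-dimensional space is unique

`HarmonicShell.eq_of_laplacian_eq_of_tendsto_cocompact`: two `C²` functions `p₁ p₂ : E → ℝ` on a
non-trivial finite-dimensional real inner-product space with `Δ p₁ = Δ p₂` everywhere and both tending to
`0` along `cocompact E` are EQUAL.  Proof: `p₁ − p₂` is `C²` with vanishing Laplacian, hence
`HarmonicOnNhd` (Mathlib); it tends to `0` at infinity, hence is bounded; Liouville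
(`Literature.Analysis.FluidPDE.isConst_of_harmonic_bounded`, Gilbarg–Trudinger Thm 2.10) makes it a
constant, and the constant is its limit `0`.

Use (ROUND-41, nsreg-p1 g33): the explicit blob pressure is THE decaying solution of
`Δp = −tr((∇u)²)`, so the centre Hessian computed from the explicit formula is the pressure Hessian.
Generic potential theory; `--supports stmt-NavierStokesRegularity-0056 --as helper`.
HONEST FRAME: elementary uniqueness lemma; nothing about item 0056 `NoTypeII` or NS regularity is proved.
-/

set_option linter.dupNamespace false

open Set Function Filter Topology InnerProductSpace
open scoped RealInnerProductSpace Laplacian ContDiff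

namespace Summit.NavierStokesRegularity.NavierStokesRegularity.Theorems.StrainDoors

namespace HarmonicShell

variable {E : Type*} [NormedAddCommGroup E] [InnerProductSpace ℝ E] [FiniteDimensional ℝ E]
  [MeasurableSpace E] [BorelSpace E]

omit [MeasurableSpace E] [BorelSpace E] in
/-- A `C²` function whose Laplacian vanishes identically is harmonic on the whole space (Mathlib's
`InnerProductSpace.HarmonicOnNhd`). -/
theorem harmonicOnNhd_univ_of_laplacian_eq_zero {d : E → ℝ} (hd : ContDiff ℝ 2 d)
    (hΔ : ∀ x, Δ d x = 0) : HarmonicOnNhd d univ := by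
  intro x _
  refine ⟨hd.contDiffAt, Filter.Eventually.of_forall fun y => ?_⟩
  simpa using hΔ y

omit [InnerProductSpace ℝ E] [FiniteDimensional ℝ E] [MeasurableSpace E] [BorelSpace E] in
/-- A continuous real function tending to `0` along `cocompact` is bounded. -/
theorem exists_abs_le_of_tendsto_cocompact {f : E → ℝ} (hf : Continuous f)
    (h0 : Tendsto f (cocompact E) (𝓝 0)) : ∃ B : ℝ, ∀ x, |f x| ≤ B := by
  have h1 : ∀ᶠ x in cocompact E, dist (f x) 0 < 1 := Metric.tendsto_nhds.1 h0 1 one_pos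
  obtain ⟨K, hK, hKs⟩ := mem_cocompact.1 h1
  obtain ⟨C, hC⟩ := hK.exists_bound_of_continuousOn hf.continuousOn
  refine ⟨max C 1, fun x => ?_⟩
  by_cases hx : x ∈ K
  · have := hC x hx
    rw [Real.norm_eq_abs] at this
    exact this.trans (le_max_left _ _)
  · have := hKs hx
    simp only [mem_setOf_eq, dist_zero_right, Real.norm_eq_abs] at this
    exact this.le.trans (le_max_right _ _)

/-- A `C²` HARMONIC function tending to `0` at infinity vanishes identically (Liouville + the limit). -/
theorem eq_zero_of_laplacian_eq_zero_of_tendsto_cocompact [Nontrivial E] {d : E → ℝ}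
    (hd : ContDiff ℝ 2 d) (hΔ : ∀ x, Δ d x = 0) (h0 : Tendsto d (cocompact E) (𝓝 0)) : d = 0 := by
  have hharm := harmonicOnNhd_univ_of_laplacian_eq_zero hd hΔ
  have hB := exists_abs_le_of_tendsto_cocompact hd.continuous h0
  rcases exists_ne (0 : E) with ⟨x₁, -⟩
  have hconst : ∀ x, d x = d 0 := fun x =>
    Literature.Analysis.FluidPDE.isConst_of_harmonic_bounded hharm hB x 0
  have hlim : Tendsto (fun _ : E => d 0) (cocompact E) (𝓝 0) :=
    h0.congr fun x => hconst x
  have hc : d 0 = 0 := tendsto_const_nhds_iff.1 hlim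
  funext x
  rw [hconst x, hc, Pi.zero_apply]

/-- **Plate E3 «PoissonUnique» (ROUND-41).** Two `C²` functions with the same Laplacian everywhere and
both tending to `0` along `cocompact E` coincide: the decaying classical solution of a Poisson equation
`Δ p = ρ` on a non-trivial finite-dimensional real inner-product space is unique. -/
theorem eq_of_laplacian_eq_of_tendsto_cocompact [Nontrivial E] {p₁ p₂ : E → ℝ}
    (h₁ : ContDiff ℝ 2 p₁) (h₂ : ContDiff ℝ 2 p₂) (hΔ : ∀ x, Δ p₁ x = Δ p₂ x)
    (hd₁ : Tendsto p₁ (cocompact E) (𝓝 0)) (hd₂ : Tendsto p₂ (cocompact E) (𝓝 0)) : p₁ = p₂ := by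
  have hd : ContDiff ℝ 2 (p₁ - p₂) := h₁.sub h₂
  have hΔ' : ∀ x, Δ (p₁ - p₂) x = 0 := fun x => by
    rw [ContDiffAt.laplacian_sub h₁.contDiffAt h₂.contDiffAt, hΔ x, sub_self]
  have h0 : Tendsto (p₁ - p₂) (cocompact E) (𝓝 0) := by
    have := hd₁.sub hd₂
    rw [sub_zero] at this
    exact this
  have := eq_zero_of_laplacian_eq_zero_of_tendsto_cocompact hd hΔ' h0
  exact sub_eq_zero.1 this

/-- E3 in the ROUND-41 frame `E = ℝ³` (the plate-map shape verbatim). -/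
theorem eq_of_laplacian_eq_of_tendsto_cocompact_three {p₁ p₂ : EuclideanSpace ℝ (Fin 3) → ℝ}
    (h₁ : ContDiff ℝ 2 p₁) (h₂ : ContDiff ℝ 2 p₂) (hΔ : ∀ x, Δ p₁ x = Δ p₂ x)
    (hd₁ : Tendsto p₁ (cocompact (EuclideanSpace ℝ (Fin 3))) (𝓝 0))
    (hd₂ : Tendsto p₂ (cocompact (EuclideanSpace ℝ (Fin 3))) (𝓝 0)) : p₁ = p₂ :=
  eq_of_laplacian_eq_of_tendsto_cocompact h₁ h₂ hΔ hd₁ hd₂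

end HarmonicShell

end Summit.NavierStokesRegularity.NavierStokesRegularity.Theorems.StrainDoors
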